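import Literature.AlgebraicGeometry.HodgeTheory.AlgebraicClassesPullback
import Literature.AlgebraicGeometry.HodgeTheory.MotivatedClassesAssembly
import Literature.AlgebraicGeometry.HodgeTheory.SupportedHodgeClassDescent
import Literature.AlgebraicGeometry.HodgeTheory.GysinKernelProofs
import Literature.AlgebraicGeometry.Motives.ComplexPointsOrientation
import HarnessLib

/-!
# Fulton's Cor. 19.2 (b) and Voisin's Prop. 9.20 are the same input on the coniveau carrier

Family `hodge`, layer `Literature/AlgebraicGeometry/HodgeTheory`. The tree carries two unproved
named facts of classical intersection theory on the carrier `algebraicClasses V p = Nᵖ H²ᵖ(V(ℂ); ℂ)`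
(classes dying off a Zariski-closed subset of codimension `≥ p`):

* `fulton1998_map_mem_algebraicClasses` (`AlgebraicClassesPullback`) — pull-back along EVERY
  morphism `j : X ⟶ Y` of smooth projective complex varieties maps `Nᵖ H²ᵖ(Y)` into `Nᵖ H²ᵖ(X)`
  (W. Fulton, *Intersection Theory*, Cor. 19.2 (b): "`cl` … contravariant for morphisms of
  non-singular varieties"; C. Voisin, *Hodge Theory and Complex Algebraic Geometry II*,
  Prop. 9.21 (i));
* `Voisin2003_cupProduct_algebraicClasses` (`MotivatedClassesAssembly`) — on every smooth
  projective complex `V`, `Nᵃ H²ᵃ ∪ Nᵇ H²ᵇ ⊆ Nᵃ⁺ᵇ H^{2(a+b)}` (Voisin II Prop. 9.20,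
  "`cl(Z · Z') = cl(Z) ∪ cl(Z')`" with Chow's moving lemma, Lemma 9.22).

Both printed proofs pass through the same geometric input (Chow's moving lemma, or Fulton's
deformation to the normal cone), and on this carrier the two statements are EQUIVALENT by formal
properties of the Gysin morphisms alone, which the tree has (projection formula
`complexGysin_cup`, functoriality `complexGysin_comp`/`complexGysin_id`, proper push-forward and flat
pull-back respect the coniveau: `complexGysin_mem_algebraicClasses`, `map_snd_mem_supportedClasses`):

* Prop. 9.20 ⟹ Cor. 19.2 (b) (`fulton1998_map_mem_algebraicClasses_of_cupProduct`): by the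
  reduction to graph morphisms already in the tree (`fulton1998_map_mem_algebraicClasses_of_graph`,
  the first step of both printed proofs: `j = γ_j ≫ pr_Y`, `pr_Y` flat) it suffices to treat
  `γ = (𝟙, j) : X ⟶ X ⊗ Y`; there `γ ≫ pr_X = 𝟙`, so for `c ∈ Nᵖ H²ᵖ(X ⊗ Y)`,
  `γ^* c = pr_{X*} γ_* (γ^* c ∪ 1) = pr_{X*} (c ∪ γ_* 1)` (projection formula; Fulton §16.1,
  Prop. 16.1.2 (c): the transpose of a graph acts as the pull-back), with `γ_* 1 ∈ Nᵐ H²ᵐ(X ⊗ Y)`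
  (`m = dim Y`, push-forward of `1 ∈ N⁰ H⁰`), `c ∪ γ_* 1 ∈ Nᵖ⁺ᵐ` (Prop. 9.20) and
  `pr_{X*} : Nᵖ⁺ᵐ H^{2(p+m)}(X ⊗ Y) → Nᵖ H²ᵖ(X)` (push-forward);
* Cor. 19.2 (b) ⟹ Prop. 9.20 (`cupProduct_algebraicClasses_of_fulton1998`): `a ∪ b = Δ^*(a × b)`
  with the exterior product algebraic unconditionally — the tree's
  `cupProduct_mem_algebraicClasses_of_forall_map_diagonal` (`AlgebraicClassesExteriorProduct`) fed
  with the fact at the diagonals;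
* `fulton1998_map_mem_algebraicClasses_iff_cupProduct` — the equivalence.

Hence whichever of the two facts is discharged first discharges the other (the tree's programme
towards Prop. 9.20 is `AlgebraicClassesCup` → `SupportedClassesIrreducible` →
`MovingLemmaExcessInduction`, reducing it to the cone step of the moving lemma). Theorems only; no
definition, no named fact (D-0026). Consumer in this unit: the `alg → alg` input `hF` of
`FermatCohomologyCurvePowerDomination.inductiveStepClause_of_blowupDiagram` (pull-back along the
non-flat blow-up of Shioda–Katsura's diagram (1.25)).

## References

* [Fulton1998] W. Fulton, *Intersection Theory*, 2nd ed. (1998), §16.1 Prop. 16.1.1–16.1.2,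
  §19.2 Cor. 19.2 (b), Prop. 19.2 (proof: reduction to the graph).
* [VoisinHodgeII2003] C. Voisin, *Hodge Theory and Complex Algebraic Geometry II*, CUP (2003),
  §9.2.4 Prop. 9.20, Prop. 9.21 (i) and its proof, Lemma 9.22.
* [FultonYoungTableaux1997] W. Fulton, *Young Tableaux*, CUP (1997), Appendix B §B.1 (5)–(6)
  (Gysin maps, projection formula).
-/

noncomputable section

open CategoryTheory AlgebraicGeometry MonoidalCategory CartesianMonoidalCategory
open Literature.AlgebraicTopology.SingularHomology

namespace Literature.AlgebraicGeometry.HodgeTheory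

section HodgeTheory

variable {m n : ℕ} {Y X : Motives.SchemeOver ℂ}

/-- **The transpose of a graph acts as the pull-back** (Fulton, Prop. 16.1.2 (c), on cohomology):
for `j : X ⟶ Y` between smooth projective varieties (`dim X = n`, `dim Y = m`), the graph
`γ = (𝟙, j) : X ⟶ X ⊗ Y`, every orientation family `μ` and every `c ∈ Hᵏ((X ⊗ Y)(ℂ); ℂ)`,
`γ^* c = pr_{X*}(c ∪ γ_* 1)`: indeed `γ ≫ pr_X = 𝟙`, so `γ^* c = (γ ≫ pr_X)_* (γ^* c) =
pr_{X*} γ_*(γ^* c ∪ 1) = pr_{X*}(c ∪ γ_* 1)` (`complexGysin_id`, `complexGysin_comp`, `cupProduct_one`,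
projection formula `complexGysin_cup`). [cite: Fulton1998, §16.1 Prop. 16.1.1 and Prop. 16.1.2 (c)]
[cite: FultonYoungTableaux1997, Appendix B §B.1 (5)–(6)] -/
theorem complexBetti_map_graph_eq_complexGysin_fst_cupProduct (μ : OrientationFamily)
    (hY : Motives.IsSmoothProjective m Y) (hX : Motives.IsSmoothProjective n X) (j : X ⟶ Y)
    {k : ℕ} (c : complexBetti (X ⊗ Y) k) :
    complexBetti.map (lift (𝟙 X) j) k c =
      complexGysin μ (Motives.IsSmoothProjective.tensor_holds hX hY) hX (fst X Y)
        (show (k + 2 * m) + 2 * n = k + 2 * (n + m) by omega)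
        (cupProduct (rfl : k + 2 * m = k + 2 * m) c
          (complexGysin μ hX (Motives.IsSmoothProjective.tensor_holds hX hY) (lift (𝟙 X) j)
            (show 0 + 2 * (n + m) = 2 * m + 2 * n by omega)
            (singularCohomology.one ℂ (Motives.ComplexPoints X)))) := by
  have hμ := OrientationFamily.hasPoincareDuality μ
  have hXY := Motives.IsSmoothProjective.tensor_holds hX hY
  -- projection formula: `c ∪ γ_* 1 = γ_* (γ^* c ∪ 1) = γ_* (γ^* c)`
  rw [← complexGysin_cup hμ hX hXY (lift (𝟙 X) j) (Nat.add_zero k)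
      (show k + 2 * (n + m) = (k + 2 * m) + 2 * n by omega)
      (show 0 + 2 * (n + m) = 2 * m + 2 * n by omega) rfl c
      (singularCohomology.one ℂ (Motives.ComplexPoints X)),
    cupProduct_one, ← LinearMap.comp_apply,
    ← complexGysin_comp hμ hX hXY hX (lift (𝟙 X) j) (fst X Y)
      (show k + 2 * (n + m) = (k + 2 * m) + 2 * n by omega)
      (show (k + 2 * m) + 2 * n = k + 2 * (n + m) by omega)]
  -- `(γ ≫ pr_X)_* = (𝟙 X)_* = 𝟙`
  simp only [lift_fst]
  rw [complexGysin_id hμ hX k, LinearMap.id_apply]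

/-- **Voisin II Prop. 9.20 ⟹ Fulton Cor. 19.2 (b) on the coniveau carrier.** If on every smooth
projective complex variety the cup product of algebraic classes is algebraic
(`Voisin2003_cupProduct_algebraicClasses`), then pull-back along every morphism of smooth
projective complex varieties preserves algebraic classes (`fulton1998_map_mem_algebraicClasses`):
reduce to graphs `γ = (𝟙, j) : X ⟶ X ⊗ Y` (`fulton1998_map_mem_algebraicClasses_of_graph`), write
`γ^* c = pr_{X*}(c ∪ γ_* 1)` (`complexBetti_map_graph_eq_complexGysin_fst_cupProduct`), and use
that `γ_* 1 ∈ Nᵐ H²ᵐ(X ⊗ Y)` and `pr_{X*}(Nᵖ⁺ᵐ) ⊆ Nᵖ` (`complexGysin_mem_algebraicClasses`, proper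
push-forward shifts the coniveau by the relative dimension) while `c ∪ γ_* 1 ∈ Nᵖ⁺ᵐ` is the
hypothesis. [cite: Fulton1998, §19.2 Cor. 19.2 (b) and proof of Prop. 19.2; §16.1 Prop. 16.1.2 (c)]
[cite: VoisinHodgeII2003, §9.2.4 Prop. 9.20 and proof of Prop. 9.21 (i)] -/
theorem fulton1998_map_mem_algebraicClasses_of_cupProduct
    (hcup : Voisin2003_cupProduct_algebraicClasses) : fulton1998_map_mem_algebraicClasses := by
  classical
  refine fulton1998_map_mem_algebraicClasses_of_graph fun m n Y X j hY hX p c hc ↦ ?_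
  let μ : OrientationFamily := fun _ _ h ↦
    Classical.choice (Motives.ComplexPoints.isOrientableOver ℂ h)
  have hμ := OrientationFamily.hasPoincareDuality μ
  have hXY := Motives.IsSmoothProjective.tensor_holds hX hY
  -- the graph class `γ_* 1 ∈ Nᵐ H²ᵐ(X ⊗ Y)`
  have h1 : complexGysin μ hX hXY (lift (𝟙 X) j) (show 0 + 2 * (n + m) = 2 * m + 2 * n by omega)
      (singularCohomology.one ℂ (Motives.ComplexPoints X)) ∈ algebraicClasses (X ⊗ Y) m :=
    complexGysin_mem_algebraicClasses (gysinMap_restrictCompl_eq_zero_of_field ℂ) μ hμ hX hXY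
      (lift (𝟙 X) j) (q := 0) (p := m) (by omega) _
      (by rw [algebraicClasses_zero]; exact Submodule.mem_top)
  -- `c ∪ γ_* 1 ∈ Nᵖ⁺ᵐ` (Prop. 9.20), in the degree bookkeeping of the push–pull identity
  have h2 : cupProduct (rfl : 2 * p + 2 * m = 2 * p + 2 * m) c
      (complexGysin μ hX hXY (lift (𝟙 X) j) (show 0 + 2 * (n + m) = 2 * m + 2 * n by omega)
        (singularCohomology.one ℂ (Motives.ComplexPoints X))) ∈
        supportedClasses (X ⊗ Y) (2 * p + 2 * m) (p + m) := by
    rw [cupProduct_mem_supportedClasses_iff rfl (two_mul_add_two_mul p m)]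
    exact hcup hXY hc h1
  -- `γ^* c = pr_{X*}(c ∪ γ_* 1)` and `pr_{X*}(Nᵖ⁺ᵐ) ⊆ Nᵖ`
  rw [complexBetti_map_graph_eq_complexGysin_fst_cupProduct μ hY hX j c]
  exact complexGysin_mem_supportedClasses (gysinMap_restrictCompl_eq_zero_of_field ℂ) μ hμ hXY hX
    (fst X Y) _ (le_of_eq (by omega)) h2

/-- **Fulton Cor. 19.2 (b) ⟹ Voisin II Prop. 9.20 on the coniveau carrier**: `a ∪ b = Δ^*(a × b)`,
the exterior product `a × b = pr₁^* a ∪ pr₂^* b` of algebraic classes being algebraic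
unconditionally (`cupProduct_mem_algebraicClasses_of_forall_map_diagonal`,
`AlgebraicClassesExteriorProduct`), and `Δ = (𝟙, 𝟙) : V ⟶ V ⊗ V` a morphism of smooth projective
varieties. [cite: VoisinHodgeII2003, §9.2.4 proof of Prop. 9.20 and Prop. 9.21 (i)]
[cite: Fulton1998, §19.2 Cor. 19.2 (b)] -/
theorem cupProduct_algebraicClasses_of_fulton1998 (hF : fulton1998_map_mem_algebraicClasses) :
    Voisin2003_cupProduct_algebraicClasses :=
  fun _ _ hV a b _ _ hx hy ↦
    cupProduct_mem_algebraicClasses_of_forall_map_diagonal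
      (fun _ _ hW p _ hc ↦ hF (lift (𝟙 _) (𝟙 _)) (Motives.IsSmoothProjective.tensor_holds hW hW) hW
        p _ hc)
      hV a b hx hy

/-- **On the coniveau carrier, Fulton's Cor. 19.2 (b) (pull-backs preserve algebraic classes) and
Voisin's Prop. 9.20 (cup products preserve algebraic classes) are equivalent.**
[cite: Fulton1998, §19.2 Cor. 19.2 (b) and §16.1 Prop. 16.1.2 (c)] [cite: VoisinHodgeII2003, §9.2.4 Prop. 9.20 and Prop. 9.21 (i)] -/
theorem fulton1998_map_mem_algebraicClasses_iff_cupProduct :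
    fulton1998_map_mem_algebraicClasses ↔ Voisin2003_cupProduct_algebraicClasses :=
  ⟨cupProduct_algebraicClasses_of_fulton1998, fulton1998_map_mem_algebraicClasses_of_cupProduct⟩

end HodgeTheory

end Literature.AlgebraicGeometry.HodgeTheory

end
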